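import Mathlib
import HarnessLib
import Summits.HubbardSuperconductivity.HubbardSuperconductivity.Theorems.KLProgrammeLatticeCellsRayData

/-!
# Route `KLProgramme` — ENGINE stmt-HubbardSuperconductivity-20437 `KLRegimeEngineV17F2`, row (c) package ζ (`EngineV8.rowC_hexOut_of_pkgζ`, …ClosersVGQOutE): the
# DYADIC ANGULAR-CELL FAMILY about one angle — the producer-side GEOMETRY half of the cell rows (cell gate-hubbard-kl, seat hubbard-kl-k3c2-p2 g26; cure (A″) route 3′ of
# located «(c)-OUT-COOPER-ANTIPODE», COOPER-ANTIPODE.md §3 / ROWC-RESIDUAL-g26.md §2)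

WHY.  Package ζ asks the producer of the dressed split for a finite family of ANGULAR CELLS `i : Fin Nc` — arcs `[αc i, βc i]` with `αc i ≤ βc i` covering `(−π, π)`,
serving finite sets `S i` of lattice momenta (`|P k − F_θ|_𝕋 ≤ r`, `θ` in the arc ⇒ `k ∈ S i`), per-cell Lipschitz constants `0 ≤ Lc i` of the pins on `S i` — priced by the ARC
CURRENCY `Σ_i Lc i·(βc i − αc i)`.  The intended discharge (memo §2) uses DYADIC RINGS about the Cooper antipode `θs`: a core arc `[θs − w, θs + w]` and, on each side, rings
`[θs + 2^m w, θs + 2^{m+1} w]` / `[θs − 2^{m+1} w, θs − 2^m w]`, `m < Mx`, with `2^{Mx}·w ≥ 2π` so that the family covers `(−π, π)` whatever `θs ∈ [−π, π]` is; the constant on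
ring `m` is the producer's `Λc m` (typically `∝ 2^{−m}`), on the core `Λ0`.  This file supplies that family and its bookkeeping ONCE, generically:
* §1 `klcdLo/klcdHi/klcdL` (indexed by `Fin (2·Mx + 1)`: `i < Mx` right ring `m = i`, `Mx ≤ i < 2Mx` left ring `m = i − Mx`, `i = 2Mx` core), `klcdLo_le_klcdHi`, `klcdL_nonneg`;
* §2 `klcd_dyadic_exists` (every `d ∈ (w, 2^{Mx} w)` lies in a ring `[2^m w, 2^{m+1} w]`, `m < Mx` — `exists_nat_pow_near`), **`klcd_cover`** (the COVER row);
* §3 **`klcd_currency_eq`**: `Σ_i klcdL i·(klcdHi i − klcdLo i) = 2·Σ_{m<Mx} Λc m·(2^m w) + Λ0·(2w)` (the ARC CURRENCY in closed form), `klcd_currency_le` (geometric instance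
  `Λc m ≤ C·(2^m)⁻¹` ⇒ `≤ 2·C·w·Mx + 2·Λ0·w`);
* §4 `klcdS` — the CANONICAL serving set (all lattice momenta within torus sup-distance `r` of a Fermi point of the arc) with `klcd_serve` (the SERVING row by definition) and
  `mem_klcdS` (what membership means, for the producer's Lipschitz proof on it);
* §5 `klcd_rows` — the four data rows of package ζ (`hαβ`, `hLc`, `hcover`, the currency identity) for this family in one statement.
Pure bookkeeping on intervals and finite sets; the analytic content (the per-ring Lipschitz constants of the dressed pair kernel and their sizes) stays with the producer.  Nothing
here asserts any row of 20437, (c), K3 or superconductivity.  0 kit · 0 lit.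
-/

noncomputable section

namespace Summit.HubbardSuperconductivity.HubbardSuperconductivity.Theorems.KLRegimeSplit

set_option linter.dupNamespace false -- summit = problem name (single-conjunct summit), D-0017

open Real Set Literature.MathematicalPhysics.QuantumLattice
open Literature.Probability.LatticeModels hiding torusSupNorm
open Summit.HubbardSuperconductivity.HubbardSuperconductivity.Theorems.KLProgrammeLegKernels
open Summit.HubbardSuperconductivity.HubbardSuperconductivity.Theorems.EngineV8
open scoped BigOperators

/-! ## §1 The dyadic family -/

/-- Lower end of cell `i` (ℕ-indexed): right ring `i < Mx` ↦ `θs + 2^i w`; left ring `Mx ≤ i < 2Mx` ↦ `θs − 2^{i−Mx+1} w`; core (`i ≥ 2Mx`) ↦ `θs − w`. -/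
def klcdLoN (θs w : ℝ) (Mx i : ℕ) : ℝ :=
  if i < Mx then θs + 2 ^ i * w else if i < 2 * Mx then θs - 2 ^ (i - Mx + 1) * w else θs - w

/-- Upper end of cell `i` (ℕ-indexed): right ring `i < Mx` ↦ `θs + 2^{i+1} w`; left ring ↦ `θs − 2^{i−Mx} w`; core ↦ `θs + w`. -/
def klcdHiN (θs w : ℝ) (Mx i : ℕ) : ℝ :=
  if i < Mx then θs + 2 ^ (i + 1) * w else if i < 2 * Mx then θs - 2 ^ (i - Mx) * w else θs + w

/-- Lipschitz constant booked on cell `i` (ℕ-indexed): ring `m` (either side) ↦ `Λc m`, core ↦ `Λ0`. -/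
def klcdLN (Λc : ℕ → ℝ) (Λ0 : ℝ) (Mx i : ℕ) : ℝ :=
  if i < Mx then Λc i else if i < 2 * Mx then Λc (i - Mx) else Λ0

/-- Lower ends of the dyadic family, indexed by `Fin (2·Mx + 1)` as package ζ wants (`αc`). -/
def klcdLo (θs w : ℝ) (Mx : ℕ) (i : Fin (2 * Mx + 1)) : ℝ := klcdLoN θs w Mx i

/-- Upper ends of the dyadic family (`βc`). -/
def klcdHi (θs w : ℝ) (Mx : ℕ) (i : Fin (2 * Mx + 1)) : ℝ := klcdHiN θs w Mx i

/-- Cell constants of the dyadic family (`Lc`). -/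
def klcdL (Λc : ℕ → ℝ) (Λ0 : ℝ) (Mx : ℕ) (i : Fin (2 * Mx + 1)) : ℝ := klcdLN Λc Λ0 Mx i

/-- Width of a right ring: `2^m w`. -/
theorem klcdHiN_sub_klcdLoN_of_lt {θs w : ℝ} {Mx i : ℕ} (hi : i < Mx) :
    klcdHiN θs w Mx i - klcdLoN θs w Mx i = 2 ^ i * w := by
  simp only [klcdHiN, klcdLoN, if_pos hi, pow_succ]
  ring

/-- Width of a left ring `i = Mx + m`: `2^m w`. -/
theorem klcdHiN_sub_klcdLoN_of_ge {θs w : ℝ} {Mx i : ℕ} (hi : Mx ≤ i) (hi' : i < 2 * Mx) :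
    klcdHiN θs w Mx i - klcdLoN θs w Mx i = 2 ^ (i - Mx) * w := by
  simp only [klcdHiN, klcdLoN, if_neg (not_lt.mpr hi), if_pos hi', pow_succ]
  ring

/-- Width of the core: `2w`. -/
theorem klcdHiN_sub_klcdLoN_core {θs w : ℝ} {Mx i : ℕ} (hi : 2 * Mx ≤ i) :
    klcdHiN θs w Mx i - klcdLoN θs w Mx i = 2 * w := by
  have h1 : ¬ i < Mx := by omega
  have h2 : ¬ i < 2 * Mx := by omega
  simp only [klcdHiN, klcdLoN, if_neg h1, if_neg h2]
  ring

/-- Every cell is a genuine interval (`hαβ` row) once `0 ≤ w`. -/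
theorem klcdLoN_le_klcdHiN {θs w : ℝ} (hw : 0 ≤ w) (Mx i : ℕ) : klcdLoN θs w Mx i ≤ klcdHiN θs w Mx i := by
  rcases Nat.lt_or_ge i Mx with hi | hi
  · have h := klcdHiN_sub_klcdLoN_of_lt (θs := θs) (w := w) hi
    have : (0 : ℝ) ≤ 2 ^ i * w := by positivity
    linarith
  rcases Nat.lt_or_ge i (2 * Mx) with hi' | hi'
  · have h := klcdHiN_sub_klcdLoN_of_ge (θs := θs) (w := w) hi hi'
    have : (0 : ℝ) ≤ 2 ^ (i - Mx) * w := by positivity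
    linarith
  · have h := klcdHiN_sub_klcdLoN_core (θs := θs) (w := w) hi'
    linarith

/-- `hαβ` row for the `Fin`-indexed family. -/
theorem klcdLo_le_klcdHi {θs w : ℝ} (hw : 0 ≤ w) (Mx : ℕ) (i : Fin (2 * Mx + 1)) :
    klcdLo θs w Mx i ≤ klcdHi θs w Mx i :=
  klcdLoN_le_klcdHiN hw Mx i

/-- `hLc` row: the booked constants are nonnegative if the producer's are. -/
theorem klcdLN_nonneg {Λc : ℕ → ℝ} {Λ0 : ℝ} (hΛc : ∀ m, 0 ≤ Λc m) (hΛ0 : 0 ≤ Λ0) (Mx i : ℕ) :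
    0 ≤ klcdLN Λc Λ0 Mx i := by
  unfold klcdLN
  split_ifs
  · exact hΛc _
  · exact hΛc _
  · exact hΛ0

/-- `hLc` row for the `Fin`-indexed family. -/
theorem klcdL_nonneg {Λc : ℕ → ℝ} {Λ0 : ℝ} (hΛc : ∀ m, 0 ≤ Λc m) (hΛ0 : 0 ≤ Λ0) (Mx : ℕ) (i : Fin (2 * Mx + 1)) :
    0 ≤ klcdL Λc Λ0 Mx i :=
  klcdLN_nonneg hΛc hΛ0 Mx i

/-! ## §2 Cover -/

/-- Dyadic localisation: every `d` with `w < d < 2^{Mx}·w` (`0 < w`) lies in a ring `[2^m w, 2^{m+1} w]` with `m < Mx`. -/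
theorem klcd_dyadic_exists {w d : ℝ} (hw : 0 < w) {Mx : ℕ} (hd1 : w < d) (hd2 : d < 2 ^ Mx * w) :
    ∃ m : ℕ, m < Mx ∧ 2 ^ m * w ≤ d ∧ d ≤ 2 ^ (m + 1) * w := by
  have hx : 1 ≤ d / w := by rw [le_div_iff₀ hw]; linarith
  obtain ⟨m, hm1, hm2⟩ := exists_nat_pow_near hx one_lt_two
  refine ⟨m, ?_, ?_, ?_⟩
  · have h : (2 : ℝ) ^ m < 2 ^ Mx := by
      refine lt_of_le_of_lt hm1 ?_
      rw [div_lt_iff₀ hw]; exact hd2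
    exact (pow_lt_pow_iff_right₀ one_lt_two).mp h
  · have := (le_div_iff₀ hw).mp hm1
    linarith
  · have := (div_lt_iff₀ hw).mp hm2
    linarith

/-- Right ring `m < Mx` as a member of the family: its ends. -/
theorem klcdLo_right {θs w : ℝ} {Mx m : ℕ} (hm : m < Mx) :
    klcdLo θs w Mx ⟨m, by omega⟩ = θs + 2 ^ m * w ∧ klcdHi θs w Mx ⟨m, by omega⟩ = θs + 2 ^ (m + 1) * w := by
  simp only [klcdLo, klcdHi, klcdLoN, klcdHiN, if_pos hm, and_self]

/-- Left ring `m < Mx` (index `Mx + m`): its ends. -/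
theorem klcdLo_left {θs w : ℝ} {Mx m : ℕ} (hm : m < Mx) :
    klcdLo θs w Mx ⟨Mx + m, by omega⟩ = θs - 2 ^ (m + 1) * w ∧ klcdHi θs w Mx ⟨Mx + m, by omega⟩ = θs - 2 ^ m * w := by
  have h1 : ¬ Mx + m < Mx := by omega
  have h2 : Mx + m < 2 * Mx := by omega
  simp only [klcdLo, klcdHi, klcdLoN, klcdHiN, if_neg h1, if_pos h2, Nat.add_sub_cancel_left, and_self]

/-- The core (index `2Mx`): its ends. -/
theorem klcdLo_core {θs w : ℝ} {Mx : ℕ} :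
    klcdLo θs w Mx ⟨2 * Mx, by omega⟩ = θs - w ∧ klcdHi θs w Mx ⟨2 * Mx, by omega⟩ = θs + w := by
  have h1 : ¬ 2 * Mx < Mx := by omega
  have h2 : ¬ 2 * Mx < 2 * Mx := lt_irrefl _
  simp only [klcdLo, klcdHi, klcdLoN, klcdHiN, if_neg h1, if_neg h2, and_self]

/-- **COVER row.**  If the centre `θs` lies in `[−π, π]`, `0 < w` and `2π ≤ 2^{Mx}·w`, the dyadic family covers `(−π, π)`. -/
theorem klcd_cover {θs w : ℝ} (hw : 0 < w) (hθs : θs ∈ Icc (-π) π) {Mx : ℕ} (hM : 2 * π ≤ 2 ^ Mx * w) :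
    ∀ θ ∈ Ioo (-π) π, ∃ i : Fin (2 * Mx + 1), θ ∈ Icc (klcdLo θs w Mx i) (klcdHi θs w Mx i) := by
  intro θ hθ
  obtain ⟨hθ1, hθ2⟩ := hθ
  obtain ⟨hs1, hs2⟩ := hθs
  rcases le_or_gt (θ - θs) w with h1 | h1
  · rcases le_or_gt (-w) (θ - θs) with h2 | h2
    · -- core
      refine ⟨⟨2 * Mx, by omega⟩, ?_⟩
      rw [klcdLo_core.1, klcdLo_core.2]
      constructor <;> linarith
    · -- left ring: d' = θs − θ ∈ (w, 2π) ⊆ (w, 2^Mx w)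
      have hd1 : w < θs - θ := by linarith
      have hd2 : θs - θ < 2 ^ Mx * w := by linarith
      obtain ⟨m, hm, hlo, hhi⟩ := klcd_dyadic_exists hw hd1 hd2
      refine ⟨⟨Mx + m, by omega⟩, ?_⟩
      rw [(klcdLo_left hm).1, (klcdLo_left hm).2]
      constructor <;> linarith
  · -- right ring: d = θ − θs ∈ (w, 2^Mx w)
    have hd2 : θ - θs < 2 ^ Mx * w := by linarith
    obtain ⟨m, hm, hlo, hhi⟩ := klcd_dyadic_exists hw h1 hd2
    refine ⟨⟨m, by omega⟩, ?_⟩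
    rw [(klcdLo_right hm).1, (klcdLo_right hm).2]
    constructor <;> linarith

/-! ## §3 The arc currency in closed form -/

/-- **ARC CURRENCY identity**: `Σ_i Lc i·(βc i − αc i)` of the dyadic family `= 2·Σ_{m<Mx} Λc m·(2^m w) + Λ0·(2w)`. -/
theorem klcd_currency_eq (θs w : ℝ) (Λc : ℕ → ℝ) (Λ0 : ℝ) (Mx : ℕ) :
    ∑ i : Fin (2 * Mx + 1), klcdL Λc Λ0 Mx i * (klcdHi θs w Mx i - klcdLo θs w Mx i) =
      2 * (∑ m ∈ Finset.range Mx, Λc m * (2 ^ m * w)) + Λ0 * (2 * w) := by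
  simp only [klcdL, klcdHi, klcdLo]
  rw [Fin.sum_univ_eq_sum_range (fun i : ℕ => klcdLN Λc Λ0 Mx i * (klcdHiN θs w Mx i - klcdLoN θs w Mx i)) (2 * Mx + 1),
    Finset.sum_range_succ, ← Finset.sum_range_add_sum_Ico _ (show Mx ≤ 2 * Mx by omega), Finset.sum_Ico_eq_sum_range,
    show 2 * Mx - Mx = Mx by omega]
  have hcore : klcdLN Λc Λ0 Mx (2 * Mx) * (klcdHiN θs w Mx (2 * Mx) - klcdLoN θs w Mx (2 * Mx)) = Λ0 * (2 * w) := by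
    rw [klcdHiN_sub_klcdLoN_core le_rfl]
    have h1 : ¬ 2 * Mx < Mx := by omega
    simp only [klcdLN, if_neg h1, lt_irrefl, if_false]
  have hright : ∑ i ∈ Finset.range Mx, klcdLN Λc Λ0 Mx i * (klcdHiN θs w Mx i - klcdLoN θs w Mx i) =
      ∑ m ∈ Finset.range Mx, Λc m * (2 ^ m * w) := by
    refine Finset.sum_congr rfl fun i hi => ?_
    have hi' : i < Mx := Finset.mem_range.mp hi
    rw [klcdHiN_sub_klcdLoN_of_lt hi']
    simp only [klcdLN, if_pos hi']
  have hleft : ∑ i ∈ Finset.range Mx, klcdLN Λc Λ0 Mx (Mx + i) * (klcdHiN θs w Mx (Mx + i) - klcdLoN θs w Mx (Mx + i)) =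
      ∑ m ∈ Finset.range Mx, Λc m * (2 ^ m * w) := by
    refine Finset.sum_congr rfl fun i hi => ?_
    have hi' : i < Mx := Finset.mem_range.mp hi
    have h1 : ¬ Mx + i < Mx := by omega
    have h2 : Mx + i < 2 * Mx := by omega
    rw [klcdHiN_sub_klcdLoN_of_ge (by omega) h2]
    simp only [klcdLN, if_neg h1, if_pos h2, Nat.add_sub_cancel_left]
  rw [hcore, hright, hleft]
  ring

/-- Geometric instance of the currency: if `Λc m ≤ C·(2^m)⁻¹` on the rings used, the arc currency is `≤ 2·C·w·Mx + Λ0·(2w)` (linear in the NUMBER of rings — the producer's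
saturation factor, when present, is booked through `klcd_currency_eq` directly). -/
theorem klcd_currency_le {θs w : ℝ} (hw : 0 ≤ w) {Λc : ℕ → ℝ} {Λ0 C : ℝ} {Mx : ℕ} (hΛc : ∀ m < Mx, Λc m ≤ C * (2 ^ m)⁻¹) :
    ∑ i : Fin (2 * Mx + 1), klcdL Λc Λ0 Mx i * (klcdHi θs w Mx i - klcdLo θs w Mx i) ≤ 2 * (C * w * Mx) + Λ0 * (2 * w) := by
  rw [klcd_currency_eq]
  have h : ∑ m ∈ Finset.range Mx, Λc m * (2 ^ m * w) ≤ ∑ m ∈ Finset.range Mx, C * w := by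
    refine Finset.sum_le_sum fun m hm => ?_
    have hm' := hΛc m (Finset.mem_range.mp hm)
    have h2 : (0 : ℝ) < 2 ^ m := by positivity
    calc Λc m * (2 ^ m * w) ≤ C * (2 ^ m)⁻¹ * (2 ^ m * w) := mul_le_mul_of_nonneg_right hm' (by positivity)
      _ = C * w := by field_simp
  rw [Finset.sum_const, Finset.card_range, nsmul_eq_mul] at h
  linarith

/-! ## §4 Canonical serving sets -/

/-- The CANONICAL serving set of an arc `[lo, hi]` at radius `r` for a Fermi-point map `F : ℝ → ℝ × ℝ`: all lattice momenta `k` whose planar representative `klpeP L k` is within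
torus sup-distance `r` of some `F θ`, `θ ∈ [lo, hi]`. -/
def klcdS (L : ℕ) [NeZero L] (F : ℝ → ℝ × ℝ) (r lo hi : ℝ) : Finset (TorusSite 2 L) := by
  classical exact Finset.univ.filter fun k => ∃ θ ∈ Icc lo hi, torusSupNorm (klpeP L k - F θ) ≤ r

/-- Membership in the canonical serving set. -/
theorem mem_klcdS {L : ℕ} [NeZero L] {F : ℝ → ℝ × ℝ} {r lo hi : ℝ} {k : TorusSite 2 L} :
    k ∈ klcdS L F r lo hi ↔ ∃ θ ∈ Icc lo hi, torusSupNorm (klpeP L k - F θ) ≤ r := by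
  classical
  unfold klcdS
  simp only [Finset.mem_filter, Finset.mem_univ, true_and]

/-- **SERVING row** for the canonical serving sets (by definition). -/
theorem klcd_serve {L : ℕ} [NeZero L] (F : ℝ → ℝ × ℝ) (r lo hi : ℝ) :
    ∀ θ ∈ Icc lo hi, ∀ k : TorusSite 2 L, torusSupNorm (klpeP L k - F θ) ≤ r → k ∈ klcdS L F r lo hi :=
  fun θ hθ _ hk => mem_klcdS.mpr ⟨θ, hθ, hk⟩

/-- SERVING row of package ζ for the dyadic family with canonical serving sets `S i := klcdS L F r (klcdLo … i) (klcdHi … i)` (any Fermi-point map `F`, e.g. the flow frame's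
`θ ↦ u(θ)·(cos θ, sin θ)`). -/
theorem klcd_serve_family {L : ℕ} [NeZero L] (F : ℝ → ℝ × ℝ) (r θs w : ℝ) (Mx : ℕ) :
    ∀ i : Fin (2 * Mx + 1), ∀ θ ∈ Icc (klcdLo θs w Mx i) (klcdHi θs w Mx i), ∀ k : TorusSite 2 L,
      torusSupNorm (klpeP L k - F θ) ≤ r → k ∈ klcdS L F r (klcdLo θs w Mx i) (klcdHi θs w Mx i) :=
  fun i => klcd_serve F r (klcdLo θs w Mx i) (klcdHi θs w Mx i)

/-! ## §5 The data rows of package ζ for the dyadic family -/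

/-- **The four data rows of package ζ for the dyadic family** — `hαβ`, `hLc`, `hcover`, and the ARC CURRENCY in closed form — from: `0 < w`, centre `θs ∈ [−π, π]`,
`2π ≤ 2^{Mx}·w`, nonnegative producer constants.  (The serving row is `klcd_serve_family`; the cell-Lipschitz rows on `klcdS …` and the size of
`2·Σ_{m<Mx} Λc m·2^m w + 2Λ0 w` against `2³⁵(Klam U)²` are the producer's analytic input.) -/
theorem klcd_rows {θs w : ℝ} (hw : 0 < w) (hθs : θs ∈ Icc (-π) π) {Mx : ℕ} (hM : 2 * π ≤ 2 ^ Mx * w)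
    {Λc : ℕ → ℝ} {Λ0 : ℝ} (hΛc : ∀ m, 0 ≤ Λc m) (hΛ0 : 0 ≤ Λ0) :
    (∀ i, klcdLo θs w Mx i ≤ klcdHi θs w Mx i) ∧
    (∀ i, 0 ≤ klcdL Λc Λ0 Mx i) ∧
    (∀ θ ∈ Ioo (-π) π, ∃ i, θ ∈ Icc (klcdLo θs w Mx i) (klcdHi θs w Mx i)) ∧
    (∑ i, klcdL Λc Λ0 Mx i * (klcdHi θs w Mx i - klcdLo θs w Mx i) =
      2 * (∑ m ∈ Finset.range Mx, Λc m * (2 ^ m * w)) + Λ0 * (2 * w)) :=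
  ⟨klcdLo_le_klcdHi hw.le Mx, klcdL_nonneg hΛc hΛ0 Mx, klcd_cover hw hθs hM, klcd_currency_eq θs w Λc Λ0 Mx⟩

end Summit.HubbardSuperconductivity.HubbardSuperconductivity.Theorems.KLRegimeSplit

end
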